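import Mathlib
import Summits.Ventures.PercRepro2.SwOutAdjGTypedPull

/-!
# The adjacent-junction theorem on the general doubly typed side, II: the theorem
(blind cell PercRepro2, night-4 g32, 2026-08-28; proofs/NIGHT4-G32.md §3)

g11's proof (SwOutAdjThm) on g7's `gTypedQ`: the side of a class is partitioned by
`ζ ↦ (aSet ζ, blockBase ζ)` into blocks (`fibre_eq_block_g` — the cores of a `gOutSide`
configuration are `h` or junctions by g31's `core_mem_J_of_out_g`, the block lemmas are the core
forms of SwOutAdjBlockCore), each satisfying the rigid counting inequality (`card_block_le_g`):
**`rigidOK_g_of_adjJunctions`** (every class of a region with ANY set `J` of junctions under the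
strong hadj, the conditions on `h`'s clusters blind to `J`), **`gTypedSwAll_of_adjJunctions`**
(g11's adjacent-junction class for g7's row — g31's `gTypedSwAll_of_junctions` without the
independence of `J`).
-/

namespace Summit.Ventures.PercRepro2

namespace LocRows

open Hull

variable {V : Type*} {E : Type*} [Fintype E] [DecidableEq E]

open scoped Classical

variable {ends : E → Sym2 V} {U : Set V} {ξ : Config E} {l h : V} {J : Set V}
  {𝓤 𝓓 𝓓'' : Set (Set V)} {X : Set V} {𝓤' : Set (Set V)}

section Main

variable {F : V → Prop}

variable (h𝓤 : IsUpperSet 𝓤) (h𝓓 : IsLowerSet 𝓓) (h𝓓'' : IsLowerSet 𝓓'') (h𝓤' : IsUpperSet 𝓤')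
  (hD'' : ∀ T ∈ 𝓓'', T ∪ J ∈ 𝓓'') (hU' : ∀ T ∈ 𝓤', T \ J ∈ 𝓤') (hJX : ∀ u ∈ J, u ∉ X)
  (hF : ∀ x, F x → (∀ S ∈ 𝓤, x ∈ S) ∨ (∀ S ∈ 𝓓'', x ∉ S) ∨ x ∈ X)
  (hl : l ∉ U) (hloop_h : ∀ e, ends e ≠ s(h, h)) (hJU : J ⊆ U) (hhJ : h ∉ J)
  (hadj : ∀ u ∈ J, ∀ e (he : u ∈ ends e), Sym2.Mem.other he ≠ h →
    ∃ e', ends e' = s(Sym2.Mem.other he, h))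
  (hout : ∀ x ∈ U, x ≠ h → x ∉ J →
    F x ∨ (∃ e y, ends e = s(x, y) ∧ y ∉ U) ∨ (∀ e, x ∉ ends e))

include hF hJU hhJ hadj hout in
/-- **The fibre of `ζ ↦ (aSet ζ, blockBase ζ)` through `ζ₁` is its block** (within the general
doubly typed side). -/
theorem fibre_eq_block_g {ζ₁ : Config E} (hζ₁ : ζ₁ ∈ gOutSide ends l h 𝓤 𝓓 𝓓'' X 𝓤' U ξ)
    (P : Config E → Prop) :
    ((gOutSide ends l h 𝓤 𝓓 𝓓'' X 𝓤' U ξ).filter P).filter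
        (fun ζ => (aSet ends J h ζ, blockBase ends (aSet ends J h ζ) h ζ) =
          (aSet ends J h ζ₁, blockBase ends (aSet ends J h ζ₁) h ζ₁)) =
      (Finset.univ.image (blockReal ends (aSet ends J h ζ₁) h ζ₁)).filter
        fun ζ' => ζ' ∈ gTypedQ ends l h 𝓤 𝓓 𝓓'' X 𝓤' ∧ P ζ' := by
  have hcore : ∀ ζ, ζ ∈ gOutSide ends l h 𝓤 𝓓 𝓓'' X 𝓤' U ξ →
      ∀ x, x ∈ cluster ends ζ h → x ∈ cluster ends (blue ζ) h → x = h ∨ x ∈ J :=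
    fun ζ hζ x hx hx' => core_mem_J_of_out_g hF hout hζ hx hx'
  have hcl₁ : ζ₁ ∈ outClass ends U h ξ := (mem_gOutSide.1 hζ₁).2
  ext ζ'
  simp only [Finset.mem_filter, Finset.mem_image, Finset.mem_univ, true_and, Prod.mk.injEq]
  constructor
  · rintro ⟨⟨hζ', hP⟩, hMeq, hbase⟩
    refine ⟨?_, (mem_gOutSide.1 hζ').1, hP⟩
    rw [hMeq] at hbase
    have hc' : CoreFree (splitEndsS ends (aSet ends J h ζ₁))
        (normRed ends (aSet ends J h ζ₁) ζ') (Sum.inl h) := by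
      rw [← hMeq]; exact coreFree_normRed_core hhJ (hcore ζ' hζ')
    obtain ⟨ω', hω'⟩ := exists_orbitReal_eq hc' hbase
    refine ⟨Sum.elim ω' (fun e => ζ' e.1), ?_⟩
    funext e
    by_cases hi : Internal ends (aSet ends J h ζ₁) e
    · rw [blockReal_of_internal _ hi]
      rfl
    · rw [blockReal_of_not_internal _ hi]
      have hcomp : (Sum.elim ω' fun e : {e : E // Internal ends (aSet ends J h ζ₁) e} => ζ' e.1) ∘
          Sum.inl = ω' := funext fun _ => rfl
      rw [hcomp, hω', normRed_of_not_internal hi]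
  · rintro ⟨⟨ω, rfl⟩, hQ', hP'⟩
    refine ⟨⟨mem_gOutSide.2 ⟨hQ',
      blockReal_mem_outClass_core hJU hhJ hadj hcl₁ (hcore ζ₁ hζ₁) ω⟩, hP'⟩,
      aSet_blockReal_core hhJ hadj (hcore ζ₁ hζ₁) ω, ?_⟩
    rw [aSet_blockReal_core hhJ hadj (hcore ζ₁ hζ₁) ω]
    unfold blockBase
    rw [normRed_blockReal ω, allRed_orbitReal (coreFree_blockBase_core hhJ (hcore ζ₁ hζ₁)) _]
    exact allRed_idem (coreFree_normRed_core hhJ (hcore ζ₁ hζ₁))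

include h𝓤 h𝓓 h𝓓'' h𝓤' hD'' hU' hJX hF hl hloop_h hJU hhJ hadj hout in
/-- **THE ADJACENT-JUNCTION THEOREM ON THE GENERAL DOUBLY TYPED SIDE**: the rigid counting
inequality on `gTypedQ` of every class of a region with ANY set `J` of junctions (adjacent
junctions allowed; no loop at `h`, `h ∉ J`, every neighbour `p ≠ h` of a junction — junction
neighbours included — adjacent to `h`, the conditions on `h`'s clusters blind to `J`, every vertex
of `U ∖ {h}` outside `J` exempt, with an outside edge, or with no edge). -/
theorem rigidOK_g_of_adjJunctions {𝓔 : Set (Set E)} (h𝓔 : IsUpperSet 𝓔) :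
    ((gOutSide ends l h 𝓤 𝓓 𝓓'' X 𝓤' U ξ).filter fun ζ => redEdges ends ζ h ∈ 𝓔).card ≤
      ((gOutSide ends l h 𝓤 𝓓 𝓓'' X 𝓤' U ξ).filter fun ζ => blueEdges ends ζ h ∈ 𝓔).card := by
  let key : Config E → Set V × Config E := fun ζ =>
    (aSet ends J h ζ, blockBase ends (aSet ends J h ζ) h ζ)
  let S₀ : Finset (Set V × Config E) := (gOutSide ends l h 𝓤 𝓓 𝓓'' X 𝓤' U ξ).image key
  have hmap : ∀ (P : Config E → Prop) (ζ : Config E),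
      ζ ∈ (gOutSide ends l h 𝓤 𝓓 𝓓'' X 𝓤' U ξ).filter P → key ζ ∈ S₀ :=
    fun P ζ hζ => Finset.mem_image_of_mem key (Finset.mem_filter.1 hζ).1
  rw [Finset.card_eq_sum_card_fiberwise (hmap _), Finset.card_eq_sum_card_fiberwise (hmap _)]
  refine Finset.sum_le_sum fun k hk => ?_
  obtain ⟨ζ₁, hζ₁, rfl⟩ := Finset.mem_image.1 hk
  rw [fibre_eq_block_g hF hJU hhJ hadj hout hζ₁, fibre_eq_block_g hF hJU hhJ hadj hout hζ₁]
  exact card_block_le_g hl hloop_h hJU hhJ hadj h𝓤 h𝓓 h𝓓'' h𝓤' hD'' hU' hJX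
    (mem_gOutSide.1 hζ₁).2 (fun x hx hx' => core_mem_J_of_out_g hF hout hζ₁ hx hx') h𝓔

end Main

section Graph

variable {F : V → Prop}

/-- **The general doubly typed row on every graph with ANY set `J` of junctions** in the region
`{l}ᶜ` (adjacent junctions allowed; `l, h ∉ J`, no loop at `h`, every neighbour `p ≠ h` of a
junction — junction neighbours included — adjacent to `h`, the conditions on `h`'s clusters blind
to `J`, every other vertex exempt, joined to `l`, or isolated) — g11's adjacent-junction class for
g7's row. -/
theorem gTypedSwAll_of_adjJunctions (hlh : l ≠ h) (hloop_h : ∀ e, ends e ≠ s(h, h)) (hlJ : l ∉ J)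
    (hhJ : h ∉ J)
    (h𝓤 : IsUpperSet 𝓤) (h𝓓 : IsLowerSet 𝓓) (h𝓓'' : IsLowerSet 𝓓'') (h𝓤' : IsUpperSet 𝓤')
    (hD'' : ∀ T ∈ 𝓓'', T ∪ J ∈ 𝓓'') (hU' : ∀ T ∈ 𝓤', T \ J ∈ 𝓤') (hJX : ∀ u ∈ J, u ∉ X)
    (hF : ∀ x, F x → (∀ S ∈ 𝓤, x ∈ S) ∨ (∀ S ∈ 𝓓'', x ∉ S) ∨ x ∈ X)
    (hadj : ∀ u ∈ J, ∀ e (he : u ∈ ends e), Sym2.Mem.other he ≠ h →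
      ∃ e', ends e' = s(Sym2.Mem.other he, h))
    (hout : ∀ x, x ≠ l → x ≠ h → x ∉ J →
      F x ∨ (∃ e, ends e = s(x, l)) ∨ (∀ e, x ∉ ends e)) :
    GTypedSwAll ends l h 𝓤 𝓓 𝓓'' X 𝓤' := by
  refine exists_swAll_injection_of_card_le h _ (card_le_g_of_classes hlh fun ξ 𝓔 h𝓔 => ?_)
  refine rigidOK_g_of_adjJunctions (ξ := ξ) (J := J) h𝓤 h𝓓 h𝓓'' h𝓤' hD'' hU' hJX hF (by simp)
    hloop_h
    (fun u hu => by
      simp only [Set.mem_compl_iff, Set.mem_singleton_iff]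
      rintro rfl
      exact hlJ hu) hhJ hadj ?_ h𝓔
  intro x hx hxh hxJ
  rcases hout x (by simpa using hx) hxh hxJ with hf | ⟨e, he⟩ | hiso
  · exact Or.inl hf
  · exact Or.inr (Or.inl ⟨e, l, he, by simp⟩)
  · exact Or.inr (Or.inr hiso)

end Graph

end LocRows

end Summit.Ventures.PercRepro2
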